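import Summits.HodgeConjecture.HodgeConjecture.Theses.PadicSemiregularLift
import Summits.HodgeConjecture.HodgeConjecture.Theorems.HodgeAbelianVarieties.Negative.ExtremeCodimensions

/-!
# Crux `HodgeAbelianVarieties` (stmt-HodgeConjecture-1333), line `inner-form-invariant-seeds`:
# the ENGINE lemmas of the open stub `stub_starSeeds` (helper file, `--supports`)

Route `PadicSemiregularLift`. The line's skeleton (`Cruxes/HodgeAbelianVarieties/Lines/inner-form-invariant-seeds.lean`,
gen 3) reduces the crux to two registered stubs, `stub_innerFormAnchors` (∃-packaged geography + classical package +
inner-form lever; known in print) and `stub_starSeeds` ((⋆)-seeds on supersingular abelian anchors = the route's P2a typed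
at abelian anchors; OPEN), and runs the route's engine BY NAME: Bloch–Esnault–Kerz Thm 1.3 (the tree's predicate
`BlochEsnaultKerzLifting C`) ⇒ rational pro-class lift; P1a `FormalLiftingFromClassLifting` (stmt-13825) ⇒
`LiftsFormally`; P3a `FormalVectorBundlesAlgebraize` (stmt-14106) ⇒ `LiftsTo`; `bo_chCris` ⇒ the Berthelot–Ogus image
of the seed class is algebraic on the generic fibre; `ℚ`-saturation. This file lands exactly those steps as sorry-free
lemmas over the TREE's vocabulary only (`CrystallineRealization`, `WittScheme.*`, `KZero`, the route decls P1a/P3a taken as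
named hypotheses — so lemmas mentioning them are CONDITIONAL on those open/known route items, by design), so that the
skeleton, the disprover and the P2a crux chain can import them. Nothing here restates the crux or a stub.

Contents: `bo_chCris_mem_span_of_liftsTo` (object-level known direction of p-adic variational Hodge),
`bo_mem_span_of_zsmul_mem_closure` (`ℚ`-saturation), `bo_mem_span_of_formalSeedClasses` (formal seeds + P3a),
`liftsFormally_of_hodgeCondition_of_star` (BEK + P1a), `bo_mem_span_of_starSeedClasses` (the whole engine),
`bo_chCris_mem_span_of_lineBundle` (`r = 1` calibration: Berthelot–Ogus 3.8 + P3a), and the complex-side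
`mem_algebraicClasses_of_extreme` (extreme codimensions on any smooth projective complex `n`-fold).

References: Bloch–Esnault–Kerz, *p-adic deformation of algebraic cycle classes*, Invent. Math. 195 (2014), Thm. 1.3;
Berthelot–Ogus, *F-isocrystals and de Rham cohomology I*, Invent. Math. 72 (1983), Thm. 3.8, Rem. 3.7.1;
line card `Cruxes/HodgeAbelianVarieties/Lines/inner-form-invariant-seeds.md`.
-/

-- `Summit.HodgeConjecture.HodgeConjecture.…` is the tree's mandated summit/problem namespace (single-problem summit):
-- the duplicated component is by design (CONVENTIONS §1), so the dupNamespace linter is silenced for this file.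
set_option linter.dupNamespace false

noncomputable section

open CategoryTheory AlgebraicGeometry
open scoped Isocrystal
open Literature.AlgebraicGeometry Literature.AlgebraicGeometry.Motives
  Literature.AlgebraicGeometry.HodgeTheory Literature.AlgebraicGeometry.Crystalline
  Literature.AlgebraicGeometry.KTheory

namespace Summit.HodgeConjecture.HodgeConjecture.Cruxes.HodgeAbelianVarieties.InnerFormInvariantSeeds.Engine

section Padic

variable {p : ℕ} [Fact p.Prime] {k : Type} [Field k] [CharP k p] [PerfectRing k p]

/-- **Classes of algebraically liftable modules are algebraic on the generic fibre** (the KNOWN direction of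
p-adic variational Hodge at object level): if `E₁` on the special fibre of a smooth proper `𝒴/W(k)` is the
restriction of a vector bundle on `𝒴`, then for every `r` the Berthelot–Ogus image of `ch_r^cris(E₁)` lies in
the `K`-span of the rational algebraic de Rham classes of the generic fibre (`bo_chCris` = Berthelot–Ogus
Rem. 3.7.1, `chDR_mem_ratAlgebraicClasses`, `chCris_congr`). [cite: BerthelotOgus1983, Rem. 3.7.1] -/
theorem bo_chCris_mem_span_of_liftsTo (C : CrystallineRealization p k) {d : ℕ}
    {𝒴 : SchemeOver (WittVector p k)} (h𝒴 : WittScheme.IsSmoothProperModel d 𝒴)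
    {E₁ : (WittScheme.specialFibre 𝒴).left.Modules} (hL : WittScheme.LiftsTo 𝒴 E₁) (r : ℕ) :
    C.bo 𝒴 (2 * r) (C.chCris (WittScheme.specialFibre 𝒴) E₁ r) ∈ Submodule.span K(p, k)
      (C.dR.ratAlgebraicClasses (WittScheme.genericFibre 𝒴) r :
        Set (C.dR.obj (WittScheme.genericFibre 𝒴) (2 * r))) := by
  obtain ⟨E, hE, ⟨e⟩⟩ := hL
  rw [← C.chCris_congr e r, C.bo_chCris h𝒴 E hE r]
  exact Submodule.subset_span (C.chDR_mem_ratAlgebraicClasses h𝒴.isSmoothProjective_genericFibre _ r)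

/-- **`ℚ`-saturation**: the classes of the special fibre whose Berthelot–Ogus image lies in the `K`-span of the
algebraic classes of the generic fibre form a `ℚ`-saturated subgroup (the preimage of a `K`-subspace, `char K = 0`);
so if every element of `S` has algebraic image and `N • u ∈ ⟨S⟩` with `N ≠ 0`, then `u` has algebraic image.
[folklore] -/
theorem bo_mem_span_of_zsmul_mem_closure (C : CrystallineRealization p k)
    (𝒴 : SchemeOver (WittVector p k)) (r : ℕ) {S : Set (C.obj (WittScheme.specialFibre 𝒴) (2 * r))}
    (hS : ∀ x ∈ S, C.bo 𝒴 (2 * r) x ∈ Submodule.span K(p, k)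
      (C.dR.ratAlgebraicClasses (WittScheme.genericFibre 𝒴) r :
        Set (C.dR.obj (WittScheme.genericFibre 𝒴) (2 * r))))
    {u : C.obj (WittScheme.specialFibre 𝒴) (2 * r)} {N : ℤ} (hN : N ≠ 0)
    (hu : N • u ∈ AddSubgroup.closure S) :
    C.bo 𝒴 (2 * r) u ∈ Submodule.span K(p, k)
      (C.dR.ratAlgebraicClasses (WittScheme.genericFibre 𝒴) r :
        Set (C.dR.obj (WittScheme.genericFibre 𝒴) (2 * r))) := by
  set V := (Submodule.span K(p, k)
      (C.dR.ratAlgebraicClasses (WittScheme.genericFibre 𝒴) r :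
        Set (C.dR.obj (WittScheme.genericFibre 𝒴) (2 * r)))).comap (C.bo 𝒴 (2 * r)) with hV
  have hle : AddSubgroup.closure S ≤ V.toAddSubgroup :=
    (AddSubgroup.closure_le _).2 fun x hx => hS x hx
  have hNu : N • u ∈ V := hle hu
  have hNK : ((N : ℤ) : K(p, k)) ≠ 0 := Int.cast_ne_zero.2 hN
  have hu' : u = ((N : K(p, k))⁻¹) • ((N : K(p, k)) • u) := by
    rw [smul_smul, inv_mul_cancel₀ hNK, one_smul]
  have key : u ∈ V := by
    rw [hu']
    refine V.smul_mem _ ?_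
    rw [Int.cast_smul_eq_zsmul]
    exact hNu
  exact key

/-- **Formal seeds + P3a**: if a non-zero multiple of `u` is a `ℤ`-combination of crystalline Chern characters
`ch_r(E)` of modules `E` on the special fibre that lift FORMALLY (`WittScheme.LiftsFormally`), then — granted the
route's typed P3a `FormalVectorBundlesAlgebraize` (Grothendieck existence; stmt-HodgeConjecture-14106), consumed by
name — the Berthelot–Ogus image of `u` is algebraic on the generic fibre. [cite: BlochEsnaultKerz2014pAdic, §1] -/
theorem bo_mem_span_of_formalSeedClasses
    (hP3a : Summit.HodgeConjecture.HodgeConjecture.Theses.PadicSemiregularLift.FormalVectorBundlesAlgebraize)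
    (C : CrystallineRealization p k) {d : ℕ} {𝒴 : SchemeOver (WittVector p k)}
    (h𝒴 : WittScheme.IsSmoothProperModel d 𝒴) {r : ℕ} {u : C.obj (WittScheme.specialFibre 𝒴) (2 * r)}
    {N : ℤ} (hN : N ≠ 0)
    (hu : N • u ∈ AddSubgroup.closure
      {x | ∃ E : (WittScheme.specialFibre 𝒴).left.Modules, WittScheme.LiftsFormally 𝒴 E ∧
        x = C.chCris (WittScheme.specialFibre 𝒴) E r}) :
    C.bo 𝒴 (2 * r) u ∈ Submodule.span K(p, k)
      (C.dR.ratAlgebraicClasses (WittScheme.genericFibre 𝒴) r :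
        Set (C.dR.obj (WittScheme.genericFibre 𝒴) (2 * r))) := by
  refine bo_mem_span_of_zsmul_mem_closure C 𝒴 r ?_ hN hu
  rintro _ ⟨E, hE, rfl⟩
  exact bo_chCris_mem_span_of_liftsTo C h𝒴 (hP3a p k d 𝒴 h𝒴 E hE) r

/-- **BEK + P1a give formal lifts of (⋆)-bundles with the Hodge condition.** For a finite locally free `E₁` on the
special fibre of a model satisfying P1a's hypotheses (smooth proper of relative dimension `d`, projective over
`W`, `d + 6 < p`, `H^b(𝒪)`/`H^b(Ω¹)` `p`-torsion-free, `Ω¹` free or `d ≤ 3`): the Bloch–Esnault–Kerz Hodge condition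
(all degrees) is condition (a) of Thm. 1.3 for `[E₁] ∈ K₀(X_k)_ℚ` (`hodgeConditionKZeroRat_of`), hence — granted the
tree's predicate `BlochEsnaultKerzLifting C` — a rational pro-class lift (`exists_lift_of_hodgeConditionKZeroRat`),
hence — granted the route's typed crux P1a `FormalLiftingFromClassLifting` (stmt-HodgeConjecture-13825), consumed by
name, with its hypothesis (⋆) CLASS-LIFTS-IMPLY-OBJECT-LIFTS written out verbatim — a compatible system of lifts
`LiftsFormally 𝒴 E₁`. [cite: BlochEsnaultKerz2014pAdic, Thm. 1.3] -/
theorem liftsFormally_of_hodgeCondition_of_star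
    (hP1a : Summit.HodgeConjecture.HodgeConjecture.Theses.PadicSemiregularLift.FormalLiftingFromClassLifting)
    (C : CrystallineRealization p k) (hBEK : BlochEsnaultKerzLifting C) {d : ℕ}
    {𝒴 : SchemeOver (WittVector p k)} (h𝒴 : WittScheme.IsSmoothProperModel d 𝒴)
    (hproj : IsProjectiveOverRing 𝒴) (hp : d + 6 < p)
    (hO : ∀ (b : ℕ) (x : structureSheafCohomology 𝒴.left b), (p : ℤ) • x = 0 → x = 0)
    (hΩ : ∀ (b : ℕ) (x : hodgeCohomologyOne 𝒴 b), (p : ℤ) • x = 0 → x = 0)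
    (hfree : d ≤ 3 ∨ Nonempty (cotangentSheaf 𝒴 ≅ SheafOfModules.free (R := 𝒴.left.ringCatSheaf) (Fin d)))
    (E₁ : (WittScheme.specialFibre 𝒴).left.Modules) (hE₁ : IsFiniteLocallyFree E₁)
    (hH : C.HodgeCondition 𝒴 E₁)
    (hstar : ∀ (n : ℕ) (F : (WittScheme.thickening 𝒴 (n + 1)).left.Modules) (hF : IsFiniteLocallyFree F),
      Nonempty ((Scheme.Modules.pullback (WittScheme.specialFibreToThickening 𝒴 n)).obj F ≅ E₁) →
      (∃ y : KZero (WittScheme.thickening 𝒴 (n + 2)).left,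
          KZero.map (WittScheme.thickeningMap 𝒴 (Nat.le_succ (n + 1))) y = KZero.of F hF) →
      ∃ F' : (WittScheme.thickening 𝒴 (n + 2)).left.Modules, IsFiniteLocallyFree F' ∧
        Nonempty ((Scheme.Modules.pullback (WittScheme.thickeningMap 𝒴 (Nat.le_succ (n + 1)))).obj F' ≅ F)) :
    WittScheme.LiftsFormally 𝒴 E₁ :=
  hP1a p k d 𝒴 h𝒴 hproj hp hO hΩ hfree E₁ hE₁ hstar
    (exists_lift_of_hodgeConditionKZeroRat C hBEK h𝒴 hproj hp ((C.hodgeConditionKZeroRat_of 𝒴 E₁ hE₁).2 hH))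

/-- **THE ENGINE of the line in one statement** ((⋆)-seeds + BEK + P1a + P3a ⟹ rational p-adic variational Hodge
for the seeded class): on a model satisfying P1a's hypotheses, if a non-zero multiple of `u` is a `ℤ`-combination
of `ch_r(E)` of finite locally free `E` on the special fibre each satisfying the BEK Hodge condition in all degrees
and (⋆), then `bo u` lies in the `K`-span of the algebraic classes of the generic fibre. Conditional on the route
items P1a (stmt-13825) and P3a (stmt-14106), taken by name. [cite: BlochEsnaultKerz2014pAdic, Thm. 1.3] -/
theorem bo_mem_span_of_starSeedClasses
    (hP1a : Summit.HodgeConjecture.HodgeConjecture.Theses.PadicSemiregularLift.FormalLiftingFromClassLifting)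
    (hP3a : Summit.HodgeConjecture.HodgeConjecture.Theses.PadicSemiregularLift.FormalVectorBundlesAlgebraize)
    (C : CrystallineRealization p k) (hBEK : BlochEsnaultKerzLifting C) {d : ℕ}
    {𝒴 : SchemeOver (WittVector p k)} (h𝒴 : WittScheme.IsSmoothProperModel d 𝒴)
    (hproj : IsProjectiveOverRing 𝒴) (hp : d + 6 < p)
    (hO : ∀ (b : ℕ) (x : structureSheafCohomology 𝒴.left b), (p : ℤ) • x = 0 → x = 0)
    (hΩ : ∀ (b : ℕ) (x : hodgeCohomologyOne 𝒴 b), (p : ℤ) • x = 0 → x = 0)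
    (hfree : d ≤ 3 ∨ Nonempty (cotangentSheaf 𝒴 ≅ SheafOfModules.free (R := 𝒴.left.ringCatSheaf) (Fin d)))
    {r : ℕ} {u : C.obj (WittScheme.specialFibre 𝒴) (2 * r)} {N : ℤ} (hN : N ≠ 0)
    (hu : N • u ∈ AddSubgroup.closure
      {x | ∃ (E : (WittScheme.specialFibre 𝒴).left.Modules) (_ : IsFiniteLocallyFree E),
        C.HodgeCondition 𝒴 E ∧
        (∀ (n : ℕ) (F : (WittScheme.thickening 𝒴 (n + 1)).left.Modules) (hF : IsFiniteLocallyFree F),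
          Nonempty ((Scheme.Modules.pullback (WittScheme.specialFibreToThickening 𝒴 n)).obj F ≅ E) →
          (∃ y : KZero (WittScheme.thickening 𝒴 (n + 2)).left,
              KZero.map (WittScheme.thickeningMap 𝒴 (Nat.le_succ (n + 1))) y = KZero.of F hF) →
          ∃ F' : (WittScheme.thickening 𝒴 (n + 2)).left.Modules, IsFiniteLocallyFree F' ∧
            Nonempty ((Scheme.Modules.pullback
              (WittScheme.thickeningMap 𝒴 (Nat.le_succ (n + 1)))).obj F' ≅ F)) ∧
        x = C.chCris (WittScheme.specialFibre 𝒴) E r}) :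
    C.bo 𝒴 (2 * r) u ∈ Submodule.span K(p, k)
      (C.dR.ratAlgebraicClasses (WittScheme.genericFibre 𝒴) r :
        Set (C.dR.obj (WittScheme.genericFibre 𝒴) (2 * r))) := by
  refine bo_mem_span_of_zsmul_mem_closure C 𝒴 r ?_ hN hu
  rintro _ ⟨E, hE, hH, hstar, rfl⟩
  exact bo_chCris_mem_span_of_liftsTo C h𝒴 (hP3a p k d 𝒴 h𝒴 E
    (liftsFormally_of_hodgeCondition_of_star hP1a C hBEK h𝒴 hproj hp hO hΩ hfree E hE hH hstar)) r

/-- **`r = 1` CALIBRATION at object level** (Berthelot–Ogus 1983 Thm. 3.8 + P3a): on a smooth proper model with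
`p ≠ 2` and `H²(𝒴, 𝒪)[p] = 0`, a rank-one `L` on the special fibre whose first crystalline Chern character is Hodge
at the lift (`bo c₁(L) ∈ F¹`) lifts formally (the tree's predicate `C.BerthelotOgusLineBundleLifting`), hence
algebraically (P3a, by name), so ALL its Chern characters have algebraic Berthelot–Ogus image on the generic fibre.
(The `r = 1` rung of the seed statement follows from this only in the Pic-form of the divisor-class pinning — a
`ℤ`-combination `Σ nᵢ c₁(Lᵢ)` that is Hodge is `c₁` of ONE line bundle classically, by `⊗`-additivity of `c₁`, which
the hypothesis structure does not carry.) [cite: BerthelotOgus1983, Thm. 3.8] -/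
theorem bo_chCris_mem_span_of_lineBundle
    (hP3a : Summit.HodgeConjecture.HodgeConjecture.Theses.PadicSemiregularLift.FormalVectorBundlesAlgebraize)
    (C : CrystallineRealization p k) (hBO : C.BerthelotOgusLineBundleLifting) {d : ℕ}
    {𝒴 : SchemeOver (WittVector p k)} (h𝒴 : WittScheme.IsSmoothProperModel d 𝒴) (hp : p ≠ 2)
    (hH2 : ∀ x : structureSheafCohomology 𝒴.left 2, (p : ℤ) • x = 0 → x = 0)
    (L : (WittScheme.specialFibre 𝒴).left.Modules) (hL : HasRank L 1)
    (hfil : C.bo 𝒴 (2 * 1) (C.chCris (WittScheme.specialFibre 𝒴) L 1) ∈ C.dR.fil (2 * 1) 1) (r : ℕ) :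
    C.bo 𝒴 (2 * r) (C.chCris (WittScheme.specialFibre 𝒴) L r) ∈ Submodule.span K(p, k)
      (C.dR.ratAlgebraicClasses (WittScheme.genericFibre 𝒴) r :
        Set (C.dR.obj (WittScheme.genericFibre 𝒴) (2 * r))) :=
  bo_chCris_mem_span_of_liftsTo C h𝒴 (hP3a p k d 𝒴 h𝒴 L ((hBO h𝒴 hp hH2 L hL).2 hfil)) r


/-- **Registered sub-goal `engine_starSeedClasses`** (the engine of `stub_starSeeds` as ONE closed statement, all
binders explicit): (⋆)-seed classes — `ℤ`-combinations of `ch_r(E)` of finite locally free `E` with the BEK Hodge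
condition in all degrees and (⋆) — have algebraic Berthelot–Ogus image on the generic fibre of any model satisfying
P1a's hypotheses, granted P1a, P3a (route items, by name) and `BlochEsnaultKerzLifting C`. Proof: `bo_mem_span_of_starSeedClasses`.
[cite: BlochEsnaultKerz2014pAdic, Thm. 1.3] -/
theorem engine_starSeedClasses : ∀ (p : ℕ) [Fact p.Prime] (k : Type) [Field k] [CharP k p] [PerfectRing k p], Summit.HodgeConjecture.HodgeConjecture.Theses.PadicSemiregularLift.FormalLiftingFromClassLifting → Summit.HodgeConjecture.HodgeConjecture.Theses.PadicSemiregularLift.FormalVectorBundlesAlgebraize → ∀ (C : CrystallineRealization p k), BlochEsnaultKerzLifting C → ∀ (d : ℕ) (𝒴 : SchemeOver (WittVector p k)), WittScheme.IsSmoothProperModel d 𝒴 → IsProjectiveOverRing 𝒴 → d + 6 < p → (∀ (b : ℕ) (x : structureSheafCohomology 𝒴.left b), (p : ℤ) • x = 0 → x = 0) → (∀ (b : ℕ) (x : hodgeCohomologyOne 𝒴 b), (p : ℤ) • x = 0 → x = 0) → (d ≤ 3 ∨ Nonempty (cotangentSheaf 𝒴 ≅ SheafOfModules.free (R := 𝒴.left.ringCatSheaf)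 (Fin d))) → ∀ (r : ℕ) (u : C.obj (WittScheme.specialFibre 𝒴) (2 * r)) (N : ℤ), N ≠ 0 → N • u ∈ AddSubgroup.closure {x | ∃ (E : (WittScheme.specialFibre 𝒴).left.Modules) (_ : IsFiniteLocallyFree E), C.HodgeCondition 𝒴 E ∧ (∀ (n : ℕ) (F : (WittScheme.thickening 𝒴 (n + 1)).left.Modules) (hF : IsFiniteLocallyFree F), Nonempty ((Scheme.Modules.pullback (WittScheme.specialFibreToThickening 𝒴 n)).obj F ≅ E) → (∃ y : KZero (WittScheme.thickening 𝒴 (n + 2)).left, KZero.map (WittScheme.thickeningMap 𝒴 (Nat.le_succ (n + 1))) y = KZero.of F hF) → ∃ F' : (WittScheme.thickening 𝒴 (n + 2)).left.Modules, IsFiniteLocallyFree F' ∧ Nonempty ((Scheme.Modules.pullback (WittScheme.thickeningMap 𝒴 (Nat.le_succ (n + 1)))).obj F' ≅ F)) ∧ x = C.chCris (WittScheme.specialFibre 𝒴) E r} → C.bo 𝒴 (2 * r) u ∈ Submodule.span K(p, k) (C.dR.ratAlgebraicClasses (WittScheme.genericFibre 𝒴) r : Set (C.dR.obj (WittScheme.genericFibre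 𝒴) (2 * r))) :=
  fun _ _ _ _ _ _ hP1a hP3a C hBEK _ _ h𝒴 hproj hp hO hΩ hfree _ _ _ hN hu =>
    bo_mem_span_of_starSeedClasses hP1a hP3a C hBEK h𝒴 hproj hp hO hΩ hfree hN hu

end Padic

/-- **Extreme codimensions are free** on any smooth projective complex `n`-fold: every class of degree `2r` with
`r = 0` or `n ≤ r` is algebraic (`r = 0`: `hodgeConjectureFor_codim_zero`; `r = n ≥ 1`: top degree,
`mem_algebraicClasses_of_degree_top`; `r > n`: the group vanishes, Hatcher Thm. 3.26(c)). This is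
`Negative.mem_algebraicClasses_of_dim_le` (p70486) with the abelian binder replaced by `IsSmoothProjective`, so that
it applies to the anchored FIBRES of the line. [cite: HatcherAT2002, §3.3 Thm. 3.26(c)] -/
theorem mem_algebraicClasses_of_extreme {n : ℕ} {X : SchemeOver ℂ} (hX : IsSmoothProjective n X)
    {r : ℕ} (hr : r = 0 ∨ n ≤ r) (c : complexBetti X (2 * r)) : c ∈ algebraicClasses X r := by
  rcases Nat.eq_zero_or_pos r with rfl | hr0
  · exact hodgeConjectureFor_codim_zero c
  have hnr : n ≤ r := hr.resolve_left (by omega)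
  rcases hnr.eq_or_lt with rfl | hlt
  · exact mem_algebraicClasses_of_degree_top hX hr0 c
  · haveI := ComplexPoints.subsingleton_singularCohomology_of_lt hX ℂ (k := 2 * r) (by omega)
    rw [Subsingleton.elim c 0]
    exact Submodule.zero_mem _

end Summit.HodgeConjecture.HodgeConjecture.Cruxes.HodgeAbelianVarieties.InnerFormInvariantSeeds.Engine

end
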